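import Literature.AlgebraicGeometry.Frobenioids.ArchimedeanFSMProofs
import HarnessLib

/-!
# Frobenioids II, Proposition 3.4 (vii), the FSM half: PROOF
# (abc-iut cell, layer L1, node `FrdII:Prop3.4(vii)`, chain LC-L1-2)

Mochizuki, *The geometry of Frobenioids II: poly-Frobenioids*, Kyushu J. Math. **62** (2008)
401–460, §3, Proposition 3.4 (vii) p. 30, proof p. 31 ll. 28–44 [cite: MochizukiFrdII2008, Prop 3.4 (vii) p.30]:

> "(vii) Let `φ` be a morphism of `F` that projects to a pull-back morphism of `F₀` and to an
> FSM-morphism (respectively, FSMI-morphism) of `D`. Then `φ` is an FSM-morphism (respectively,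
> FSMI-morphism) of `F`." Proof: "… given any morphism `ψ₀ : C₀ → B₀`, any factorization
> `ψ_{D₀} = φ_{D₀} ∘ ζ_{D₀}` … lifts to a factorization `ψ₀ = φ₀ ∘ ζ₀` [cf. the definition of a
> "pull-back morphism"]. Thus [cf. the observation of (i)] the fiberwise-surjectivity of `φ` follows
> immediately from that of the projection `φ_D` … To show that `φ` is a monomorphism, let `α, β` …
> since `φ_D` is a monomorphism … `α_D, β_D` coincide, hence `α_{D₀}, β_{D₀}` coincide. Thus, again by
> the definition of a "pull-back morphism", `α₀ = β₀`, hence `α = β`."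

PROVED here (proof-only, nothing defined), for `F = A, N, R`: the FSM half
(`A.isFSM_of_pullback`, `N.isFSM_of_pullback`, `R.isFSM_of_pullback`, bundled `prop34_vii_fsm`) —
exactly the printed argument, the lift of (i) being `C0.exists_lift`. The FSMI half goes in print
through item (v) ("it follows from assertion (v) that it suffices to show that `φ` is an
FSM-morphism") and is not proved in this file. No side is taken on [IUTchIII] Cor. 3.12.
-/

namespace Literature.AlgebraicGeometry.Frobenioids

open CategoryTheory

namespace ArchFrd

universe v u

variable {D : Type u} [Category.{v} D] (π : D ⥤ D0)

/-- **Prop. 3.4 (vii), FSM half, `F = A`**: an arrow of the angular Frobenioid whose projection to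
`A₀` is a pull-back morphism and whose projection to `D` is an FSM-morphism is an FSM-morphism.
[cite: MochizukiFrdII2008, Prop 3.4 (vii) p.30] -/
theorem A.isFSM_of_pullback ⦃X Y : A π⦄ (φ : X ⟶ Y)
    (hpb : PreFrobenioid.IsPullbackMorphism A0.toElem ((A.toA0 π).map φ))
    (hD : IsFSM ((A.toBase π).map φ)) : IsFSM φ := by
  obtain ⟨⟨X0, XD, ιX⟩⟩ := X
  obtain ⟨⟨Y0, YD, ιY⟩⟩ := Y
  obtain ⟨⟨φ0, φD, wφ⟩, hφiso⟩ := φ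
  obtain ⟨hfsD, hmonoD⟩ := hD
  change IsFiberwiseSurjective φD at hfsD
  change Mono φD at hmonoD
  refine ⟨?_, ⟨fun {V} a b hab => ?_⟩⟩
  · -- fiberwise-surjectivity
    intro W γ
    obtain ⟨⟨W0, WD, ιW⟩⟩ := W
    obtain ⟨⟨γ0, γD, wγ⟩, hγiso⟩ := γ
    obtain ⟨VD, δ1D, δ2D, hsq⟩ := hfsD γD
    -- lift δ2D into W (the observation of (i))
    obtain ⟨R, hR, ψ₀, hb, -, -, hψiso⟩ := C0.exists_lift W0 (π.map δ2D ≫ ιW.inv)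
    let V0 : C0 := ⟨π.obj VD, R, hR⟩
    let V : C π := ⟨V0, VD, Iso.refl _⟩
    have hb' : (PreFrobenioid.baseFunctor C0.toElem).map ψ₀ = π.map δ2D ≫ ιW.inv := hb
    have wψ : (PreFrobenioid.baseFunctor C0.toElem).map ψ₀ ≫ ιW.hom = V.iso.hom ≫ π.map δ2D :=
      ((Iso.eq_comp_inv ιW).mp hb').trans (Category.id_comp _).symm
    let δ₂C : V ⟶ (⟨W0, WD, ιW⟩ : C π) := ⟨ψ₀, δ2D, wψ⟩
    have hψiso' : PreFrobenioid.Div C0.toElem ψ₀ = 1 := hψiso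
    have hδ₂iso : PreFrobenioid.isometricMorphisms (C.toElem π) δ₂C := by
      change pull _ _ (PreFrobenioid.Div C0.toElem ψ₀) = 1
      rw [hψiso', map_one]
    -- the pull-back datum (ψ₀ ≫ γ₀, π(δ1D)) and its preimage δ₁₀
    have hb'' : (PreFrobenioid.baseFunctor C0.toElem).map ψ₀ ≫ ιW.hom = π.map δ2D :=
      wψ.trans (Category.id_comp _)
    have hcond : (PreFrobenioid.baseFunctor C0.toElem).map ψ₀ ≫
        (PreFrobenioid.baseFunctor C0.toElem).map γ0 =
        (π.map δ1D ≫ ιX.inv) ≫ (PreFrobenioid.baseFunctor C0.toElem).map φ0 := by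
      rw [← cancel_mono ιY.hom]
      calc ((PreFrobenioid.baseFunctor C0.toElem).map ψ₀ ≫
            (PreFrobenioid.baseFunctor C0.toElem).map γ0) ≫ ιY.hom
          = (PreFrobenioid.baseFunctor C0.toElem).map ψ₀ ≫
              ((PreFrobenioid.baseFunctor C0.toElem).map γ0 ≫ ιY.hom) := Category.assoc _ _ _
        _ = (PreFrobenioid.baseFunctor C0.toElem).map ψ₀ ≫ (ιW.hom ≫ π.map γD) := by rw [wγ]
        _ = ((PreFrobenioid.baseFunctor C0.toElem).map ψ₀ ≫ ιW.hom) ≫ π.map γD :=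
            (Category.assoc _ _ _).symm
        _ = π.map δ2D ≫ π.map γD := congrArg (· ≫ π.map γD) hb''
        _ = π.map (δ2D ≫ γD) := (π.map_comp _ _).symm
        _ = π.map (δ1D ≫ φD) := by rw [hsq]
        _ = π.map δ1D ≫ π.map φD := π.map_comp _ _
        _ = π.map δ1D ≫ ιX.inv ≫ ιX.hom ≫ π.map φD := by rw [Iso.inv_hom_id_assoc]
        _ = π.map δ1D ≫ ιX.inv ≫ ((PreFrobenioid.baseFunctor C0.toElem).map φ0 ≫ ιY.hom) := by
            rw [wφ]
        _ = ((π.map δ1D ≫ ιX.inv) ≫ (PreFrobenioid.baseFunctor C0.toElem).map φ0) ≫ ιY.hom := by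
            simp only [Category.assoc]
    let ψA : (⟨V0⟩ : A0) ⟶ ⟨W0⟩ := ⟨ψ₀, hψiso⟩
    let γA : (⟨W0⟩ : A0) ⟶ ⟨Y0⟩ := ⟨γ0, hγiso⟩
    let φA : (⟨X0⟩ : A0) ⟶ ⟨Y0⟩ := ⟨φ0, hφiso⟩
    obtain ⟨δA, hδ⟩ := (hpb ⟨V0⟩).2 ⟨(ψA ≫ γA, π.map δ1D ≫ ιX.inv), hcond⟩
    have h1 : δA ≫ φA = ψA ≫ γA := congrArg (fun p => p.1.1) hδ
    have h2 : (PreFrobenioid.baseFunctor C0.toElem).map δA.hom = π.map δ1D ≫ ιX.inv :=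
      congrArg (fun p => p.1.2) hδ
    have w₁ : (PreFrobenioid.baseFunctor C0.toElem).map δA.hom ≫ ιX.hom = V.iso.hom ≫ π.map δ1D :=
      ((Iso.eq_comp_inv ιX).mp h2).trans (Category.id_comp _).symm
    let δ₁C : V ⟶ (⟨X0, XD, ιX⟩ : C π) := ⟨δA.hom, δ1D, w₁⟩
    have hδ₁iso : PreFrobenioid.isometricMorphisms (C.toElem π) δ₁C := by
      have h : PreFrobenioid.Div C0.toElem δA.hom = 1 := δA.property
      change pull _ _ (PreFrobenioid.Div C0.toElem δA.hom) = 1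
      rw [h, map_one]
    refine ⟨⟨V⟩, ⟨δ₁C, hδ₁iso⟩, ⟨δ₂C, hδ₂iso⟩, ?_⟩
    apply WideSubcategory.hom_ext _
    exact CFP.hom_ext (congrArg (fun f => f.hom) h1) hsq
  · -- monomorphism
    haveI := hmonoD
    have hDeq : a.hom.snd = b.hom.snd := by
      have := congrArg (fun f => f.hom.snd) hab
      exact (cancel_mono φD).mp this
    have hC : a.hom.fst ≫ φ0 = b.hom.fst ≫ φ0 := congrArg (fun f => f.hom.fst) hab
    have hA : (PreFrobenioid.baseFunctor C0.toElem).map a.hom.fst =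
        (V.obj.iso.hom ≫ π.map a.hom.snd) ≫ ιX.inv := (Iso.eq_comp_inv ιX).mpr a.hom.w
    have hB : (PreFrobenioid.baseFunctor C0.toElem).map b.hom.fst =
        (V.obj.iso.hom ≫ π.map b.hom.snd) ≫ ιX.inv := (Iso.eq_comp_inv ιX).mpr b.hom.w
    have hbase : (PreFrobenioid.baseFunctor C0.toElem).map a.hom.fst =
        (PreFrobenioid.baseFunctor C0.toElem).map b.hom.fst := by
      rw [hA, hB, hDeq]
    have hinj := (hpb ⟨V.obj.fst⟩).1
      (a₁ := (A.toA0 π).map a) (a₂ := (A.toA0 π).map b)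
      (Subtype.ext (Prod.ext (WideSubcategory.hom_ext _ hC) hbase))
    have h0 : a.hom.fst = b.hom.fst := congrArg (fun f => f.hom) hinj
    apply WideSubcategory.hom_ext _
    exact CFP.hom_ext h0 hDeq

/-- **Prop. 3.4 (vii), FSM half, `F = N`**: an arrow of the non-rigidified angloid whose projection to
`N₀` is a pull-back morphism (for the structure `N₀ → C₀ → F_{Φ₀}`) and whose projection to `D` is an
FSM-morphism is an FSM-morphism. [cite: MochizukiFrdII2008, Prop 3.4 (vii) p.30] -/
theorem N.isFSM_of_pullback ⦃X Y : N π⦄ (φ : X ⟶ Y)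
    (hpb : PreFrobenioid.IsPullbackMorphism (N0.toC0 ⋙ C0.toElem) ((N.toN0 π).map φ))
    (hD : IsFSM ((N.toBase π).map φ)) : IsFSM φ := by
  obtain ⟨⟨⟨X0, XD, ιX⟩⟩⟩ := X
  obtain ⟨⟨⟨Y0, YD, ιY⟩⟩⟩ := Y
  obtain ⟨⟨⟨φ0, φD, wφ⟩, hφiso⟩, hφlin⟩ := φ
  obtain ⟨hfsD, hmonoD⟩ := hD
  change IsFiberwiseSurjective φD at hfsD
  change Mono φD at hmonoD
  refine ⟨?_, ⟨fun {V} a b hab => ?_⟩⟩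
  · -- fiberwise-surjectivity
    intro W γ
    obtain ⟨⟨⟨W0, WD, ιW⟩⟩⟩ := W
    obtain ⟨⟨⟨γ0, γD, wγ⟩, hγiso⟩, hγlin⟩ := γ
    obtain ⟨VD, δ1D, δ2D, hsq⟩ := hfsD γD
    obtain ⟨R, hR, ψ₀, hb, hd, -, hψiso⟩ := C0.exists_lift W0 (π.map δ2D ≫ ιW.inv)
    let V0 : C0 := ⟨π.obj VD, R, hR⟩
    let V : C π := ⟨V0, VD, Iso.refl _⟩
    have hb' : (PreFrobenioid.baseFunctor C0.toElem).map ψ₀ = π.map δ2D ≫ ιW.inv := hb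
    have wψ : (PreFrobenioid.baseFunctor C0.toElem).map ψ₀ ≫ ιW.hom = V.iso.hom ≫ π.map δ2D :=
      ((Iso.eq_comp_inv ιW).mp hb').trans (Category.id_comp _).symm
    let δ₂C : V ⟶ (⟨W0, WD, ιW⟩ : C π) := ⟨ψ₀, δ2D, wψ⟩
    have hψiso' : PreFrobenioid.Div C0.toElem ψ₀ = 1 := hψiso
    have hδ₂iso : PreFrobenioid.isometricMorphisms (C.toElem π) δ₂C := by
      change pull _ _ (PreFrobenioid.Div C0.toElem ψ₀) = 1
      rw [hψiso', map_one]
    have hδ₂lin : PreFrobenioid.linearMorphisms (A.toElem π)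
        (⟨δ₂C, hδ₂iso⟩ : (⟨V⟩ : A π) ⟶ ⟨⟨W0, WD, ιW⟩⟩) := (hd : C0.degFr ψ₀ = 1)
    have hb'' : (PreFrobenioid.baseFunctor C0.toElem).map ψ₀ ≫ ιW.hom = π.map δ2D :=
      wψ.trans (Category.id_comp _)
    have hcond : (PreFrobenioid.baseFunctor C0.toElem).map ψ₀ ≫
        (PreFrobenioid.baseFunctor C0.toElem).map γ0 =
        (π.map δ1D ≫ ιX.inv) ≫ (PreFrobenioid.baseFunctor C0.toElem).map φ0 := by
      rw [← cancel_mono ιY.hom]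
      calc ((PreFrobenioid.baseFunctor C0.toElem).map ψ₀ ≫
            (PreFrobenioid.baseFunctor C0.toElem).map γ0) ≫ ιY.hom
          = (PreFrobenioid.baseFunctor C0.toElem).map ψ₀ ≫
              ((PreFrobenioid.baseFunctor C0.toElem).map γ0 ≫ ιY.hom) := Category.assoc _ _ _
        _ = (PreFrobenioid.baseFunctor C0.toElem).map ψ₀ ≫ (ιW.hom ≫ π.map γD) := by rw [wγ]
        _ = ((PreFrobenioid.baseFunctor C0.toElem).map ψ₀ ≫ ιW.hom) ≫ π.map γD :=
            (Category.assoc _ _ _).symm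
        _ = π.map δ2D ≫ π.map γD := congrArg (· ≫ π.map γD) hb''
        _ = π.map (δ2D ≫ γD) := (π.map_comp _ _).symm
        _ = π.map (δ1D ≫ φD) := by rw [hsq]
        _ = π.map δ1D ≫ π.map φD := π.map_comp _ _
        _ = π.map δ1D ≫ ιX.inv ≫ ιX.hom ≫ π.map φD := by rw [Iso.inv_hom_id_assoc]
        _ = π.map δ1D ≫ ιX.inv ≫ ((PreFrobenioid.baseFunctor C0.toElem).map φ0 ≫ ιY.hom) := by
            rw [wφ]
        _ = ((π.map δ1D ≫ ιX.inv) ≫ (PreFrobenioid.baseFunctor C0.toElem).map φ0) ≫ ιY.hom := by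
            simp only [Category.assoc]
    let ψN : (⟨⟨V0⟩⟩ : N0) ⟶ ⟨⟨W0⟩⟩ := N0.homMk ψ₀ hψiso hd
    let γN : (⟨⟨W0⟩⟩ : N0) ⟶ ⟨⟨Y0⟩⟩ := ⟨⟨γ0, hγiso⟩, hγlin⟩
    let φN : (⟨⟨X0⟩⟩ : N0) ⟶ ⟨⟨Y0⟩⟩ := ⟨⟨φ0, hφiso⟩, hφlin⟩
    obtain ⟨δN, hδ⟩ := (hpb ⟨⟨V0⟩⟩).2 ⟨(ψN ≫ γN, π.map δ1D ≫ ιX.inv), hcond⟩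
    have h1 : δN ≫ φN = ψN ≫ γN := congrArg (fun p => p.1.1) hδ
    have h2 : (PreFrobenioid.baseFunctor C0.toElem).map δN.hom.hom = π.map δ1D ≫ ιX.inv :=
      congrArg (fun p => p.1.2) hδ
    have w₁ : (PreFrobenioid.baseFunctor C0.toElem).map δN.hom.hom ≫ ιX.hom = V.iso.hom ≫ π.map δ1D :=
      ((Iso.eq_comp_inv ιX).mp h2).trans (Category.id_comp _).symm
    let δ₁C : V ⟶ (⟨X0, XD, ιX⟩ : C π) := ⟨δN.hom.hom, δ1D, w₁⟩
    have hδ₁iso : PreFrobenioid.isometricMorphisms (C.toElem π) δ₁C := by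
      have h : PreFrobenioid.Div C0.toElem δN.hom.hom = 1 := δN.hom.property
      change pull _ _ (PreFrobenioid.Div C0.toElem δN.hom.hom) = 1
      rw [h, map_one]
    have hδ₁lin : PreFrobenioid.linearMorphisms (A.toElem π)
        (⟨δ₁C, hδ₁iso⟩ : (⟨V⟩ : A π) ⟶ ⟨⟨X0, XD, ιX⟩⟩) := (δN.property : C0.degFr δN.hom.hom = 1)
    refine ⟨⟨⟨V⟩⟩, ⟨⟨δ₁C, hδ₁iso⟩, hδ₁lin⟩, ⟨⟨δ₂C, hδ₂iso⟩, hδ₂lin⟩, ?_⟩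
    apply WideSubcategory.hom_ext _
    apply WideSubcategory.hom_ext _
    exact CFP.hom_ext (congrArg (fun f => f.hom.hom) h1) hsq
  · -- monomorphism
    haveI := hmonoD
    have hDeq : a.hom.hom.snd = b.hom.hom.snd := by
      have := congrArg (fun f => f.hom.hom.snd) hab
      exact (cancel_mono φD).mp this
    have hC : a.hom.hom.fst ≫ φ0 = b.hom.hom.fst ≫ φ0 := congrArg (fun f => f.hom.hom.fst) hab
    have hA : (PreFrobenioid.baseFunctor C0.toElem).map a.hom.hom.fst =
        (V.obj.obj.iso.hom ≫ π.map a.hom.hom.snd) ≫ ιX.inv := (Iso.eq_comp_inv ιX).mpr a.hom.hom.w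
    have hB : (PreFrobenioid.baseFunctor C0.toElem).map b.hom.hom.fst =
        (V.obj.obj.iso.hom ≫ π.map b.hom.hom.snd) ≫ ιX.inv := (Iso.eq_comp_inv ιX).mpr b.hom.hom.w
    have hbase : (PreFrobenioid.baseFunctor C0.toElem).map a.hom.hom.fst =
        (PreFrobenioid.baseFunctor C0.toElem).map b.hom.hom.fst := by
      rw [hA, hB, hDeq]
    have hinj := (hpb ⟨⟨V.obj.obj.fst⟩⟩).1
      (a₁ := (N.toN0 π).map a) (a₂ := (N.toN0 π).map b)
      (Subtype.ext (Prod.ext (WideSubcategory.hom_ext _ (WideSubcategory.hom_ext _ hC)) hbase))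
    have h0 : a.hom.hom.fst = b.hom.hom.fst := congrArg (fun f => f.hom.hom) hinj
    apply WideSubcategory.hom_ext _
    apply WideSubcategory.hom_ext _
    exact CFP.hom_ext h0 hDeq

/-- **Prop. 3.4 (vii), FSM half, `F = R`**: an arrow of the rigidified angloid whose projection to
`R₀` is a pull-back morphism (for the structure `R₀ → C₀ → F_{Φ₀}`) and whose projection to `D` is an
FSM-morphism is an FSM-morphism. [cite: MochizukiFrdII2008, Prop 3.4 (vii) p.30] -/
theorem R.isFSM_of_pullback ⦃X Y : R π⦄ (φ : X ⟶ Y)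
    (hpb : PreFrobenioid.IsPullbackMorphism (R0.toC0 ⋙ C0.toElem) ((R.toR0 π).map φ))
    (hD : IsFSM ((R.toBase π).map φ)) : IsFSM φ := by
  obtain ⟨rX, XD, ιX⟩ := X
  obtain ⟨rY, YD, ιY⟩ := Y
  obtain ⟨φO, φD, wφ⟩ := φ
  obtain ⟨hfsD, hmonoD⟩ := hD
  change IsFiberwiseSurjective φD at hfsD
  change Mono φD at hmonoD
  refine ⟨?_, ⟨fun {V} a b hab => ?_⟩⟩
  · -- fiberwise-surjectivity
    intro W γ
    obtain ⟨rW, WD, ιW⟩ := W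
    obtain ⟨γO, γD, wγ⟩ := γ
    obtain ⟨VD, δ1D, δ2D, hsq⟩ := hfsD γD
    obtain ⟨R', hR', ψ₀, hb, hd, -, hψiso⟩ := C0.exists_lift rW.left.obj.obj (π.map δ2D ≫ ιW.inv)
    let V0 : C0 := ⟨π.obj VD, R', hR'⟩
    let ψN : (⟨⟨V0⟩⟩ : N0) ⟶ rW.left := N0.homMk ψ₀ hψiso hd
    let rV : R0 := Over.mk (ψN ≫ rW.hom)
    let ψO : rV ⟶ rW := Over.homMk ψN rfl
    let V : R π := ⟨rV, VD, Iso.refl _⟩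
    have hb' : R0.toD0.map ψO = π.map δ2D ≫ ιW.inv := hb
    have wψ : R0.toD0.map ψO ≫ ιW.hom = V.iso.hom ≫ π.map δ2D :=
      ((Iso.eq_comp_inv ιW).mp hb').trans (Category.id_comp _).symm
    have hb'' : R0.toD0.map ψO ≫ ιW.hom = π.map δ2D := wψ.trans (Category.id_comp _)
    have hcond : R0.toD0.map ψO ≫ R0.toD0.map γO = (π.map δ1D ≫ ιX.inv) ≫ R0.toD0.map φO := by
      rw [← cancel_mono ιY.hom]
      calc (R0.toD0.map ψO ≫ R0.toD0.map γO) ≫ ιY.hom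
          = R0.toD0.map ψO ≫ (R0.toD0.map γO ≫ ιY.hom) := Category.assoc _ _ _
        _ = R0.toD0.map ψO ≫ (ιW.hom ≫ π.map γD) := by rw [wγ]
        _ = (R0.toD0.map ψO ≫ ιW.hom) ≫ π.map γD := (Category.assoc _ _ _).symm
        _ = π.map δ2D ≫ π.map γD := congrArg (· ≫ π.map γD) hb''
        _ = π.map (δ2D ≫ γD) := (π.map_comp _ _).symm
        _ = π.map (δ1D ≫ φD) := by rw [hsq]
        _ = π.map δ1D ≫ π.map φD := π.map_comp _ _
        _ = π.map δ1D ≫ ιX.inv ≫ ιX.hom ≫ π.map φD := by rw [Iso.inv_hom_id_assoc]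
        _ = π.map δ1D ≫ ιX.inv ≫ (R0.toD0.map φO ≫ ιY.hom) := by rw [wφ]
        _ = ((π.map δ1D ≫ ιX.inv) ≫ R0.toD0.map φO) ≫ ιY.hom := by simp only [Category.assoc]
    obtain ⟨δO, hδ⟩ := (hpb rV).2 ⟨(ψO ≫ γO, π.map δ1D ≫ ιX.inv), hcond⟩
    have h1 : δO ≫ φO = ψO ≫ γO := congrArg (fun p => p.1.1) hδ
    have h2 : R0.toD0.map δO = π.map δ1D ≫ ιX.inv := congrArg (fun p => p.1.2) hδ
    have w₁ : R0.toD0.map δO ≫ ιX.hom = V.iso.hom ≫ π.map δ1D :=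
      ((Iso.eq_comp_inv ιX).mp h2).trans (Category.id_comp _).symm
    refine ⟨V, ⟨δO, δ1D, w₁⟩, ⟨ψO, δ2D, wψ⟩, ?_⟩
    exact CFP.hom_ext h1 hsq
  · -- monomorphism
    haveI := hmonoD
    have hDeq : a.snd = b.snd := by
      have := congrArg (fun f => f.snd) hab
      exact (cancel_mono φD).mp this
    have hC : a.fst ≫ φO = b.fst ≫ φO := congrArg (fun f => f.fst) hab
    have hA : R0.toD0.map a.fst = (V.iso.hom ≫ π.map a.snd) ≫ ιX.inv := (Iso.eq_comp_inv ιX).mpr a.w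
    have hB : R0.toD0.map b.fst = (V.iso.hom ≫ π.map b.snd) ≫ ιX.inv := (Iso.eq_comp_inv ιX).mpr b.w
    have hbase : R0.toD0.map a.fst = R0.toD0.map b.fst := by rw [hA, hB, hDeq]
    have h0 : a.fst = b.fst :=
      (hpb V.fst).1 (a₁ := a.fst) (a₂ := b.fst) (Subtype.ext (Prod.ext hC hbase))
    exact CFP.hom_ext h0 hDeq

/-- **Proposition 3.4 (vii), FSM half, PROVED for `F = A, N, R`**: "Let `φ` be a morphism of `F` that
projects to a pull-back morphism of `F₀` and to an FSM-morphism of `D`. Then `φ` is an FSM-morphism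
of `F`." (The FSMI half, which print derives from item (v), is not proved here.)
[cite: MochizukiFrdII2008, Prop 3.4 (vii) p.30] -/
theorem prop34_vii_fsm :
    (∀ ⦃X Y : A π⦄ (φ : X ⟶ Y), PreFrobenioid.IsPullbackMorphism (towerA π).str0 ((towerA π).toF0.map φ) →
      IsFSM ((towerA π).toD.map φ) → IsFSM φ) ∧
    (∀ ⦃X Y : N π⦄ (φ : X ⟶ Y), PreFrobenioid.IsPullbackMorphism (towerN π).str0 ((towerN π).toF0.map φ) →
      IsFSM ((towerN π).toD.map φ) → IsFSM φ) ∧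
    (∀ ⦃X Y : R π⦄ (φ : X ⟶ Y), PreFrobenioid.IsPullbackMorphism (towerR π).str0 ((towerR π).toF0.map φ) →
      IsFSM ((towerR π).toD.map φ) → IsFSM φ) :=
  ⟨A.isFSM_of_pullback π, N.isFSM_of_pullback π, R.isFSM_of_pullback π⟩

end ArchFrd

end Literature.AlgebraicGeometry.Frobenioids
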